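import Summits.CriticalPhenomena.PercolationContinuityZ3.Theorems.PercNearOneGluingAdditiveGluingThreeRelaysTie
import HarnessLib

/-! # Crux `PercNearOneGluing.AdditiveGluing` (stmt-CriticalPhenomena-4576): the ALL-TIE assembly —
# `AdditiveGluing` from the tie-locus three-relay certificate and the tie instances with at least four relays

Support file (`--supports stmt-CriticalPhenomena-4576`, lead prim-png-lead-4576).  No definitions, no named facts, no sorries.
An ALTERNATIVE composition to the official line `starglue` (skeleton v11: T1-tie + STAR-drift-4), offered to provers who prefer a
residual that is an instance of the crux itself: by the pointwise minimiser-tie reduction (`additiveGluing_pointwise_of_minTie`,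
landed) every instance reduces to one where the two least reliable relays tie; with at most three relays besides the target this is
`additiveGluing_of_erase_card_le_three_of_tieRegionCert` (landed, from the registered stub `stub_regionCertThreeRelaysTie_pl`), and
with at least four it is the registered stub `stub_additiveGluingTieFour_pl` (= `AdditiveGluing` restricted to
`4 ≤ (A.erase b).card` AND a tie at the minimum of `μ(·↔b)` on `A`).
* `additiveGluing_of_tieStubs` : T1-tie → AG-tie(≥4) → `AdditiveGluing`.
[cite: KozmaNitzan2024, §5.3 (p. 34), Theorem 2 (§3.2)]
-/

namespace Summit.CriticalPhenomena.PercolationContinuityZ3.Theorems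

open MeasureTheory Set Literature.Probability.LatticeModels Literature.Probability.Percolation

noncomputable section
open Classical

/-- **`AdditiveGluing` from the two tie-locus stubs**: the three-relay bad-region certificate on the tie locus
(`stub_regionCertThreeRelaysTie_pl`) and the crux restricted to tie instances with at least four relays besides the target
(`stub_additiveGluingTieFour_pl`). [cite: KozmaNitzan2024, §5.3 (p. 34)] -/
theorem additiveGluing_of_tieStubs
    (hCert : ∀ (n : ℕ) (w : Sym2 (Fin n) → unitInterval) (o b a₁ a₂ a₃ : Fin n), a₁ ≠ a₂ → a₁ ≠ a₃ → a₂ ≠ a₃ → (prodBernoulli w).real (openConn a₃ b) ≤ (prodBernoulli w).real (openConn a₁ b) → (prodBernoulli w).real (openConn a₃ b) ≤ (prodBernoulli w).real (openConn a₂ b) → (prodBernoulli w).real (openConn a₁ b) ≤ (prodBernoulli w).real (openConn a₃ b) → (prodBernoulli w).real (openConn o b) < (prodBernoulli w).real (openConn a₃ b) → (prodBernoulli w).real ((openConn a₁ a₃)ᶜ ∩ (openConn a₂ a₃)ᶜ ∩ (openConn a₁ b ∩ openConn a₂ b)) < (prodBernoulli w).real ((openConn a₁ a₃)ᶜ ∩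 (openConn a₂ a₃)ᶜ ∩ openConn a₃ b) → 0 ≤ (prodBernoulli w).real ((openConn a₁ a₃)ᶜ ∩ (openConn a₂ a₃)ᶜ ∩ (openConn a₁ o ∪ openConn a₂ o)) * (prodBernoulli w).real ((openConn a₁ a₂)ᶜ ∩ (openConn a₁ a₃)ᶜ : Set (BondConfig (Fin n))) * (prodBernoulli w).real ((openConn a₂ a₁)ᶜ ∩ (openConn a₂ a₃)ᶜ : Set (BondConfig (Fin n))) * ((prodBernoulli w).real ((openConn a₁ a₃)ᶜ ∩ (openConn a₂ a₃)ᶜ ∩ (openConn a₁ b ∩ openConn a₂ b)) - (prodBernoulli w).real ((openConn a₁ a₃)ᶜ ∩ (openConn a₂ a₃)ᶜ ∩ openConn a₃ b)) + (prodBernoulli w).real ((openConn a₁ a₂)ᶜ ∩ (openConn a₁ a₃)ᶜ ∩ openConn a₁ o) * (prodBernoulli w).real ((openConn a₁ a₃)ᶜ ∩ (openConn a₂ a₃)ᶜ : Set (BondConfig (Fin n))) * (prodBernoulli w).real ((openConn a₂ a₁)ᶜ ∩ (openConn a₂ a₃)ᶜ : Set (BondConfig (Fin n))) * ((prodBernoulli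 w).real ((openConn a₁ a₂)ᶜ ∩ (openConn a₁ a₃)ᶜ ∩ openConn a₁ b) - (prodBernoulli w).real ((openConn a₁ a₂)ᶜ ∩ (openConn a₁ a₃)ᶜ ∩ (openConn a₂ b ∩ openConn a₃ b))) + (prodBernoulli w).real ((openConn a₂ a₁)ᶜ ∩ (openConn a₂ a₃)ᶜ ∩ openConn a₂ o) * (prodBernoulli w).real ((openConn a₁ a₃)ᶜ ∩ (openConn a₂ a₃)ᶜ : Set (BondConfig (Fin n))) * (prodBernoulli w).real ((openConn a₁ a₂)ᶜ ∩ (openConn a₁ a₃)ᶜ : Set (BondConfig (Fin n))) * ((prodBernoulli w).real ((openConn a₂ a₁)ᶜ ∩ (openConn a₂ a₃)ᶜ ∩ openConn a₂ b) - (prodBernoulli w).real ((openConn a₂ a₁)ᶜ ∩ (openConn a₂ a₃)ᶜ ∩ (openConn a₁ b ∩ openConn a₃ b))) + (prodBernoulli w).real ((openConn a₁ a₂)ᶜ ∩ (openConn a₁ a₃)ᶜ : Set (BondConfig (Fin n))) * (prodBernoulli w).real ((openConn a₂ a₁)ᶜ ∩ (openConn a₂ a₃)ᶜ : Set (BondConfig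 (Fin n))) * (prodBernoulli w).real ((openConn a₁ a₃)ᶜ ∩ (openConn a₂ a₃)ᶜ : Set (BondConfig (Fin n))) * (prodBernoulli w).real ((openConn o a₁ ∪ openConn o a₂ ∪ openConn o a₃)ᶜ ∩ (openConn a₃ b)ᶜ : Set (BondConfig (Fin n))))
    (hFour : ∀ (n : ℕ) (w : Sym2 (Fin n) → unitInterval) (A : Finset (Fin n)) (o b : Fin n) (t : ℝ), 4 ≤ (A.erase b).card → (∃ a ∈ A, ∃ a' ∈ A, a ≠ a' ∧ (prodBernoulli w).real (openConn a b) = (prodBernoulli w).real (openConn a' b) ∧ ∀ c ∈ A, (prodBernoulli w).real (openConn a b) ≤ (prodBernoulli w).real (openConn c b)) → 0 ≤ t → (∀ a ∈ A, 1 - t ≤ (prodBernoulli w).real (openConn a b)) → (prodBernoulli w).real (⋃ a ∈ A, openConn o a) - t ≤ (prodBernoulli w).real (openConn o b)) :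
    Summit.CriticalPhenomena.PercolationContinuityZ3.Theses.PercNearOneGluing.AdditiveGluing := by
  intro n w A o b t ht hrel
  by_cases h3 : (A.erase b).card ≤ 3
  · exact additiveGluing_of_erase_card_le_three_of_tieRegionCert hCert n w A o b t h3 ht hrel
  · have h4 : 4 ≤ (A.erase b).card := by omega
    exact additiveGluing_pointwise_of_minTie n A o b (fun w' htie t' ht' hrel' => hFour n w' A o b t' h4 htie ht' hrel') w t ht hrel

end

end Summit.CriticalPhenomena.PercolationContinuityZ3.Theorems
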